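import Summits.AtomisticToContinuum.Crystallization.Theorems.ThreeConeCertificateDefs
import Literature.MathematicalPhysics.StatisticalMechanics.LennardJonesClusters

/-!
# `OnePercentCertificate` (stmt-AtomisticToContinuum-11958) — line `perron-gauge`: the bond-weight checker

Line `perron-gauge-Sketch` (skeleton `Cruxes/OnePercentCertificate/Lines/perron_gauge_Sketch.lean`, lead
prover-line-stmt-AtomisticToContinuum-11958-a1-0).  The ENERGY form of the line's certificate checker (card
`Ideas/perron-gauge.md`, §First lemma, "bond-weight lemma"): for a pair potential `g` split as `g = rep − att` with
`att = max (−g) 0`, `rep = max g 0`, ANY bond weights `w` with `w_ij + w_ji ≥ 2` on every ordered pair give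
`2·E_g(x) ≥ −Σ_i B_w(i)`, `B_w(i) := Σ_{j≠i} (att(r_ij) w_ij − rep(r_ij))`; hence a configuration all of whose
weighted stars satisfy `B_w(i) ≤ 2c` has `E_g(x) ≥ −c·N` (`stable_of_bondWeights`).  Additive transfers
(`w = 1 ± τ`), multiplicative gauges (`w_ij = p_j/p_i`, cf. `PerronGauge.schur_test`, p142535) and the site-ball Perron weights
with AM–GM defect repair (`w'_ij = w_ij + ½ max(0, 2 − w_ij − w_ji)`) all qualify.  Stated for a general `g`, `c`;
Props inlined, no definitions. [folklore]
-/

noncomputable section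

open scoped BigOperators
open Literature.MathematicalPhysics.StatisticalMechanics

namespace Summit.AtomisticToContinuum.Crystallization.Theorems.PerronGauge

/-- **Bond-weight lemma (weighted stars bound the energy).** For bond weights with `w_ij + w_ji ≥ 2` on every
pair `i ≠ j`: `−Σ_i Σ_{j≠i} (att(r_ij) w_ij − rep(r_ij)) ≤ 2·E_g(x)`, where `att = max (−g) 0`, `rep = max g 0`
(termwise: `att_ij = att_ij (w_ij + w_ji)/2 − att_ij (w_ij + w_ji − 2)/2 ≤ (att_ij w_ij + att_ji w_ji)/2`).
[folklore] -/
theorem neg_sum_bondStar_le :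
    ∀ (g : ℝ → ℝ) (N : ℕ) (x : Fin N → EuclideanSpace ℝ (Fin 3)) (w : Fin N → Fin N → ℝ),
      (∀ i j, i ≠ j → 2 ≤ w i j + w j i) →
      -(∑ i, ∑ j ∈ Finset.univ.erase i,
          (max (-g (dist (x i) (x j))) 0 * w i j - max (g (dist (x i) (x j))) 0))
        ≤ 2 * interactionEnergy g x := by
  intro g N x w hw
  -- 2E = Σ_i Σ_{j≠i} (rep − att)
  have h2 : 2 * interactionEnergy g x
      = ∑ i, ∑ j ∈ Finset.univ.erase i, max (g (dist (x i) (x j))) 0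
        - ∑ i, ∑ j ∈ Finset.univ.erase i, max (-g (dist (x i) (x j))) 0 := by
    rw [two_mul_interactionEnergy, ← Finset.sum_sub_distrib]
    refine Finset.sum_congr rfl fun i _ => ?_
    rw [← Finset.sum_sub_distrib]
    exact Finset.sum_congr rfl fun j _ => (max_zero_sub_max_neg_zero_eq_self _).symm
  -- Σ att ≤ Σ att·w by symmetrisation
  have hswap : ∑ i, ∑ j ∈ Finset.univ.erase i, max (-g (dist (x j) (x i))) 0 * w j i
      = ∑ j, ∑ i ∈ Finset.univ.erase j, max (-g (dist (x j) (x i))) 0 * w j i := by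
    refine Finset.sum_comm' ?_
    intro i j
    simp only [Finset.mem_univ, Finset.mem_erase, true_and, and_true, ne_comm]
  have hsym : ∑ i, ∑ j ∈ Finset.univ.erase i, max (-g (dist (x i) (x j))) 0 * w i j
      = (∑ i, ∑ j ∈ Finset.univ.erase i,
          (max (-g (dist (x i) (x j))) 0 * w i j + max (-g (dist (x j) (x i))) 0 * w j i)) / 2 := by
    rw [eq_div_iff (two_ne_zero' ℝ), Finset.sum_congr rfl fun i _ => Finset.sum_add_distrib (s := Finset.univ.erase i),
      Finset.sum_add_distrib, hswap]
    ring
  have hle : ∑ i, ∑ j ∈ Finset.univ.erase i, max (-g (dist (x i) (x j))) 0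
      ≤ ∑ i, ∑ j ∈ Finset.univ.erase i, max (-g (dist (x i) (x j))) 0 * w i j := by
    rw [hsym, le_div_iff₀ (two_pos : (0 : ℝ) < 2)]
    rw [Finset.sum_mul]
    refine Finset.sum_le_sum fun i _ => ?_
    rw [Finset.sum_mul]
    refine Finset.sum_le_sum fun j hj => ?_
    have hij : i ≠ j := (Finset.ne_of_mem_erase hj).symm
    have hwij := hw i j hij
    have hnn : 0 ≤ max (-g (dist (x i) (x j))) 0 := le_max_right _ _
    rw [dist_comm (x j) (x i)]
    nlinarith
  rw [Finset.sum_congr rfl fun i _ => Finset.sum_sub_distrib (s := Finset.univ.erase i)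
      (f := fun j => max (-g (dist (x i) (x j))) 0 * w i j) (g := fun j => max (g (dist (x i) (x j))) 0),
    Finset.sum_sub_distrib]
  linarith

/-- **Stability from weighted stars.** If some bond weights `w` with `w_ij + w_ji ≥ 2` on all pairs make every
weighted star small, `Σ_{j≠i} (att(r_ij) w_ij − rep(r_ij)) ≤ 2c`, then `−c·N ≤ E_g(x)`. [folklore] -/
theorem stable_of_bondWeights :
    ∀ (g : ℝ → ℝ) (c : ℝ) (N : ℕ) (x : Fin N → EuclideanSpace ℝ (Fin 3)) (w : Fin N → Fin N → ℝ),
      (∀ i j, i ≠ j → 2 ≤ w i j + w j i) →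
      (∀ i, ∑ j ∈ Finset.univ.erase i,
        (max (-g (dist (x i) (x j))) 0 * w i j - max (g (dist (x i) (x j))) 0) ≤ 2 * c) →
      -(c * (N : ℝ)) ≤ interactionEnergy g x := by
  intro g c N x w hw hstar
  have h1 := neg_sum_bondStar_le g N x w hw
  have h2 : ∑ i, ∑ j ∈ Finset.univ.erase i,
      (max (-g (dist (x i) (x j))) 0 * w i j - max (g (dist (x i) (x j))) 0) ≤ ∑ _i : Fin N, 2 * c :=
    Finset.sum_le_sum fun i _ => hstar i
  rw [Finset.sum_const, Finset.card_univ, Fintype.card_fin, nsmul_eq_mul] at h2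
  linarith

end Summit.AtomisticToContinuum.Crystallization.Theorems.PerronGauge
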